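import Literature.Probability.LatticeModels.IsingPlusEdwardsSokal
import Literature.Probability.LatticeModels.IsingTransport
import Literature.Probability.LatticeModels.RandomClusterEdgeDensities
import Literature.Probability.LatticeModels.GKSInequalities
import Literature.Probability.LatticeModels.BodineauTranslationInvariantInput
import HarnessLib

/-!
# The Edwards–Sokal edge-density dictionary: `h⁰(p,2) = p(1 + ⟨σ_xσ_y⟩^∅)/2`,
# `h¹(p,2) = p(1 + ⟨σ_xσ_y⟩⁺)/2` for neighbours `x ∼ y` of `ℤ^d`, `p = 1 - e^{-2β}`

Topic `Literature/Probability/LatticeModels`. The tree has the free two-point Edwards–Sokal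
identity (`edwardsSokal_twoPoint_holds`, Grimmett 2006, Thm. (1.16)), the plus-boundary one-point
identity on boxes (`isingCorr_plus_box_eq_rcMeasure_real`), the limiting free and wired edge
densities `h⁰_{p,q}(e)`, `h¹_{p,q}(e)` of the random-cluster model on `ℤ^d`
(`freeEdgeDensity`/`wiredEdgeDensity`, Grimmett 2006, (4.61)) and the free and plus Ising states
`⟨·⟩^∅_{β,0}`, `⟨·⟩⁺_{β,0}` (`freeCorr`/`plusCorr`). This file proves the dictionary between the
two for the nearest-neighbour two-point functions (Grimmett 2006, Thm. (1.13)(b)/(1.16) in finite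
volume, Thm. (4.91)(b) in infinite volume: "given `σ`, an edge `e = ⟨x,y⟩` with `σ_x = σ_y` is open
with probability `p`", so that `φ(e open) = p · π(σ_x = σ_y) = p(1 + ⟨σ_xσ_y⟩)/2` for Ising spins):

* `rcMeasure_real_edgeOpen_eq_of_adj` — for every finite graph, wired set `B`, `p ∈ [0,1]`, `q > 0`
  and edge `e = ⟨u,v⟩`: `q · φ^B_{G,p,q}(e open) = p · (1 + (q-1) · φ^B_{G,p,q}(u ↔ v))`, where `↔`
  allows passage through the wired set (Grimmett 2006, Thm. (3.1)(a), eq. (3.3), summed over the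
  configuration off `e`);
* `isingCorr_plus_box_pair_eq_rcMeasure_real` — the plus-boundary two-point Edwards–Sokal identity
  on a box: `⟨σ_xσ_y⟩⁺_{Λ_n;β} = φ^{∂Λ_{n+1}}_{⟨ℰ^b_{Λ_n}⟩,p,2}(x ↔ y)` (wired connection);
* `boxFreeEdgeProb_two_eq`, `boxWiredEdgeProb_two_succ_eq` — finite volume:
  `φ⁰_{Λ_N,p,2}(e open) = p(1 + ⟨σ_xσ_y⟩^∅_{Λ_N;β})/2` and
  `φ¹_{Λ_{n+1},p,2}(e open) = p(1 + ⟨σ_xσ_y⟩⁺_{Λ_n;β})/2`;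
* `freeEdgeDensity_two_eq`, `wiredEdgeDensity_two_eq` — **the dictionary**: for neighbours `x ∼ y`
  of `ℤ^d` and `β ≥ 0`, `h⁰(p,2) = p(1 + ⟨σ_xσ_y⟩^∅_{β,0})/2`, `h¹(p,2) = p(1 + ⟨σ_xσ_y⟩⁺_{β,0})/2`,
  `p = 1 - e^{-2β}`;
* `freeEdgeDensity_eq_wiredEdgeDensity_of_nn_freeCorr_eq_plusCorr` — hence `h⁰(p,2) = h¹(p,2)` at
  every edge as soon as `⟨σ_0σ_{eᵢ}⟩^∅_β = ⟨σ_0σ_{eᵢ}⟩⁺_β` for one direction `i` (the hypothesis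
  `hgood` of `iInf_boxWiredReal_le_iSup_boxFreeReal`, Grimmett 2006, Thm. (4.63) (c)⇒(d)); in
  particular from Raoufi 2020, Prop. 1 (`Raoufi2020_nn_freeCorr_eq_plusCorr`, a named fact of the
  tree) at every `β ≥ 0`: `freeEdgeDensity_eq_wiredEdgeDensity_two_of_raoufi`; and conversely
  `nn_freeCorr_eq_plusCorr_iff_edgeDensity_eq` for `β > 0`;
* `iInf_boxWiredReal_le_iSup_boxFreeReal_two_of_nn_freeCorr_eq_plusCorr` / `…_two_of_raoufi` —
  the composed consequence for increasing box events: `inf_k φ¹_{Λ_{m+k},p,2}(A) ≤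
  sup_k φ⁰_{Λ_{m+k},p,2}(A)` (Grimmett 2006, Thm. (4.63) (c)⇒(d)).

Everything is proved; no named facts are introduced.

## Proof

The random-cluster identity is the pairing `ω ↦ (ω ∖ e, ω ∪ e)` of configurations: with
`a(η) = p^{|η|}(1-p)^{|E∖e∖η|}` one has `w(η) = a(η)(1-p)q^{k(η)}`, `w(η ∪ e) = a(η) p q^{k(η∪e)}`
and `k(η ∪ e) = k(η) - 1[u ↮ v in η]` (`card_connectedComponent_sup_edge_of_reachable`,
`card_connectedComponent_sup_edge_lt`), whence termwise `q · p · q^{k(η∪e)} = p((1-p)q^{k(η)}(1 +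
(q-1)1[u ↔ v in η]) + p q^{k(η∪e)} q)`. The plus two-point identity is Grimmett's (1.17)–(1.19)
with the wired boundary, verbatim as in `IsingPlusEdwardsSokal.lean`, the configuration sum being
`2^{k^∂(ω)-1}` if `x ↔ y` (wired sense) and `0` otherwise (flip the open cluster of whichever of
`x, y` is not joined to the boundary). The finite-volume dictionaries combine these with the free
two-point identity transported to the box (`isingTwoPoint_free_map`) and, on the wired side, with
the domain Markov property integrating out the ring edges of `Λ_{n+1}`
(`rcMeasure_real_eq_fromEdgeSet_of_outside_wired`); the infinite-volume statements follow by
passing to the (monotone) box limits on both sides (`tendsto_boxFreeEdgeProb`,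
`tendsto_boxWiredEdgeProb`, `hasBoxLimit_isingCorr_free_holds`, `hasBoxLimit_isingCorr_plus_holds`).

## References

* G. Grimmett, *The Random-Cluster Model*, Springer 2006: Thm. (1.13)(b), (1.14)–(1.16), §1.4
  (1.17)–(1.19); Thm. (3.1)(a) eq. (3.3); §4.2 (4.11)–(4.13); (4.61); Thm. (4.63); Thm. (4.91)(b).
  [Grimmett2006]
* R. G. Edwards, A. D. Sokal, Phys. Rev. D 38 (1988) 2009–2012. [EdwardsSokal1988]
* A. Raoufi, *Translation-invariant Gibbs states of the Ising model: general setting*, Ann. Probab.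
  48 (2020) 760–777, Prop. 1. [Raoufi2020]
* S. Friedli, Y. Velenik, *Statistical Mechanics of Lattice Systems* (2017), §3.1 (volumes and
  boundary conditions), Thm. 3.17 / Exercise 3.16 (the states `⟨·⟩⁺`, `⟨·⟩^∅`). [FriedliVelenik2017]
-/

noncomputable section

namespace Literature.Probability.LatticeModels

open MeasureTheory Finset SimpleGraph Filter Topology
open Literature.Barriers.CriticalPhenomena Literature.Probability.Percolation

/-! ### The one-edge identity of the random-cluster measure -/

section OneEdge

variable {V : Type*} [Fintype V] [DecidableEq V] (G : SimpleGraph V) [DecidableRel G.Adj]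

omit [Fintype V] in
/-- Opening an edge `⟨u,v⟩` on top of `η`: the wired open graph gains the edge `uv`. [folklore] -/
private theorem openGraph_insert_sup_wired (η : Finset (Sym2 V)) (B : Set V) (u v : V) :
    openGraph (↑(insert s(u, v) η) : BondConfig V) ⊔ wired B =
      (openGraph (↑η : BondConfig V) ⊔ wired B) ⊔ edge u v := by
  rw [Finset.coe_insert]
  change fromEdgeSet (insert s(u, v) (↑η : Set (Sym2 V))) ⊔ wired B = _
  rw [Set.insert_eq, fromEdgeSet_union, sup_comm (fromEdgeSet {s(u, v)}), sup_right_comm]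
  rfl

/-- The wired cluster counts of `η` and `η ∪ {⟨u,v⟩}`: equal if `u ↔ v` already (through `η` and
the wired set), otherwise opening the edge merges two clusters:
`q^{k(η ∪ e) + 1} = q^{k(η)} · (q if u ↔ v else 1)`.
[cite: Grimmett2006, Thm. (3.1)(a), proof of eq. (3.3) (p. 37)] -/
theorem pow_clusterCount_insert_succ (q : ℝ) (η : Finset (Sym2 V)) (B : Set V) (u v : V)
    [Decidable ((openGraph (↑η : BondConfig V) ⊔ wired B).Reachable u v)] :
    q ^ (clusterCount (↑(insert s(u, v) η) : BondConfig V) B + 1) =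
      q ^ clusterCount (↑η : BondConfig V) B *
        (if (openGraph (↑η : BondConfig V) ⊔ wired B).Reachable u v then q else 1) := by
  unfold clusterCount
  rw [openGraph_insert_sup_wired]
  split_ifs with hreach
  · rw [card_connectedComponent_sup_edge_of_reachable _ hreach, pow_succ]
  · have h1 := card_connectedComponent_sup_edge_lt _ hreach
    have h2 := card_connectedComponent_le_sup_edge_add_one
      (openGraph (↑η : BondConfig V) ⊔ wired B) u v
    have hk : Nat.card (openGraph (↑η : BondConfig V) ⊔ wired B).ConnectedComponent =
        Nat.card ((openGraph (↑η : BondConfig V) ⊔ wired B) ⊔ edge u v).ConnectedComponent + 1 := by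
      omega
    rw [hk, mul_one]

/-- **The one-edge identity** (Grimmett 2006, Thm. (3.1)(a), eq. (3.3), summed over the
configuration off `e`; for integer `q` it is Thm. (1.13)(b) combined with Thm. (1.16)): for a finite
graph `G`, a wired set `B`, `p ∈ [0,1]`, `q > 0` and an edge `e = ⟨u,v⟩` of `G`,
`q · φ^B_{G,p,q}(e open) = p · (1 + (q - 1) · φ^B_{G,p,q}(u ↔ v))`, where `u ↔ v` means that `u`
and `v` are joined in the open graph with `B` wired. (Eq. (3.3): given the other edges, `e` is open
with probability `p` if its endpoints are already joined and `p/(p + q(1-p))` otherwise.)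
[cite: Grimmett2006, Thm. (3.1)(a), eq. (3.3) (p. 37); Thm. (1.13)(b) and Thm. (1.16)] -/
theorem rcMeasure_real_edgeOpen_eq_of_adj {p q : ℝ} (hp : p ∈ Set.Icc (0 : ℝ) 1) (hq : 0 < q)
    (B : Set V) {u v : V} (huv : G.Adj u v) :
    q * (rcMeasure G p q B).real {ω | s(u, v) ∈ ω} =
      p * (1 + (q - 1) * (rcMeasure G p q B).real {ω | (openGraph ω ⊔ wired B).Reachable u v}) := by
  classical
  set e : Sym2 V := s(u, v) with he_def
  have huv' : u ≠ v := huv.ne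
  have he : e ∈ G.edgeFinset := mem_edgeFinset.2 huv
  set E' : Finset (Sym2 V) := G.edgeFinset.erase e with hE'
  have hE : G.edgeFinset = insert e E' := (Finset.insert_erase he).symm
  have heE' : e ∉ E' := Finset.notMem_erase e _
  have hZ := rcPartitionFunction_pos G hp hq B
  set Z := rcPartitionFunction G p q B with hZdef
  set w : Finset (Sym2 V) → ℝ := rcWeight G p q B with hw
  set R : Finset (Sym2 V) → Prop :=
    fun ω => (openGraph (↑ω : BondConfig V) ⊔ wired B).Reachable u v with hR
  -- the weights of `η` and `η ∪ {e}` for `η ⊆ E ∖ {e}`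
  set a : Finset (Sym2 V) → ℝ := fun η => p ^ #η * (1 - p) ^ #(E' \ η) with ha
  have hw0 : ∀ η ∈ E'.powerset, w η = a η * (1 - p) * q ^ clusterCount (↑η : BondConfig V) B := by
    intro η hη
    have hηE : η ⊆ E' := Finset.mem_powerset.1 hη
    have heη : e ∉ η := fun h => heE' (hηE h)
    have hsd : G.edgeFinset \ η = insert e (E' \ η) := by
      rw [hE, Finset.insert_sdiff_of_notMem _ heη]
    have hcard : #(G.edgeFinset \ η) = #(E' \ η) + 1 := by
      rw [hsd, Finset.card_insert_of_notMem fun h => heE' (Finset.mem_sdiff.1 h).1]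
    simp only [hw, rcWeight, hcard, pow_succ, ha]
    ring
  have hw1 : ∀ η ∈ E'.powerset,
      w (insert e η) = a η * p * q ^ clusterCount (↑(insert e η) : BondConfig V) B := by
    intro η hη
    have hηE : η ⊆ E' := Finset.mem_powerset.1 hη
    have heη : e ∉ η := fun h => heE' (hηE h)
    have hsd : G.edgeFinset \ insert e η = E' \ η := by
      rw [hE, Finset.insert_sdiff_insert, Finset.sdiff_insert_of_notMem heE']
    simp only [hw, rcWeight, hsd, Finset.card_insert_of_notMem heη, pow_succ, ha]
    ring
  -- the three sums
  have hN1 : (∑ ω ∈ G.edgeFinset.powerset, if e ∈ ω then w ω else 0) =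
      ∑ η ∈ E'.powerset, a η * p * q ^ clusterCount (↑(insert e η) : BondConfig V) B := by
    rw [hE, Finset.sum_powerset_insert heE']
    have h0 : (∑ η ∈ E'.powerset, if e ∈ η then w η else 0) = 0 := by
      refine Finset.sum_eq_zero fun η hη => ?_
      rw [if_neg fun h => heE' (Finset.mem_powerset.1 hη h)]
    rw [h0, zero_add]
    refine Finset.sum_congr rfl fun η hη => ?_
    rw [if_pos (Finset.mem_insert_self e η), hw1 η hη]
  have hZsum : Z = ∑ η ∈ E'.powerset, (a η * (1 - p) * q ^ clusterCount (↑η : BondConfig V) B +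
      a η * p * q ^ clusterCount (↑(insert e η) : BondConfig V) B) := by
    rw [hZdef, rcPartitionFunction, hE, Finset.sum_powerset_insert heE', ← Finset.sum_add_distrib]
    refine Finset.sum_congr rfl fun η hη => ?_
    rw [← hw, hw0 η hη, hw1 η hη]
  have hN2 : (∑ ω ∈ G.edgeFinset.powerset, if R ω then w ω else 0) =
      ∑ η ∈ E'.powerset, ((if R η then a η * (1 - p) * q ^ clusterCount (↑η : BondConfig V) B else 0) +
        a η * p * q ^ clusterCount (↑(insert e η) : BondConfig V) B) := by
    rw [hE, Finset.sum_powerset_insert heE', ← Finset.sum_add_distrib]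
    refine Finset.sum_congr rfl fun η hη => ?_
    have hR1 : R (insert e η) := by
      simp only [hR]
      refine Adj.reachable ((sup_adj _ _ _ _).2 (Or.inl ?_))
      rw [openGraph_adj]
      exact ⟨by simp [he_def], huv'⟩
    rw [if_pos hR1, hw1 η hη]
    congr 1
    split_ifs
    · rw [hw0 η hη]
    · rfl
  -- the termwise identity
  have hmain : q * (∑ ω ∈ G.edgeFinset.powerset, if e ∈ ω then w ω else 0) =
      p * (Z + (q - 1) * ∑ ω ∈ G.edgeFinset.powerset, if R ω then w ω else 0) := by
    rw [hN1, hZsum, hN2, Finset.mul_sum, Finset.mul_sum, ← Finset.sum_add_distrib, Finset.mul_sum]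
    refine Finset.sum_congr rfl fun η _ => ?_
    have hk := pow_clusterCount_insert_succ q η B u v
    rw [pow_succ, ← he_def] at hk
    by_cases hRη : R η
    · rw [if_pos hRη]
      simp only [hR] at hRη
      rw [if_pos hRη] at hk
      linear_combination (a η * p * (1 - p)) * hk
    · rw [if_neg hRη]
      simp only [hR] at hRη
      rw [if_neg hRη] at hk
      linear_combination (a η * p * (1 - p)) * hk
  -- divide by the partition function
  have h1 : (rcMeasure G p q B).real {ω | s(u, v) ∈ ω} =
      (∑ ω ∈ G.edgeFinset.powerset, if e ∈ ω then w ω else 0) / Z := by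
    rw [rcMeasure_real_eq_sum_div G hp hq B]
    congr 1
    refine Finset.sum_congr rfl fun ω _ => ?_
    simp only [Set.mem_setOf_eq, Finset.mem_coe, he_def, hw]
  have h2 : (rcMeasure G p q B).real {ω | (openGraph ω ⊔ wired B).Reachable u v} =
      (∑ ω ∈ G.edgeFinset.powerset, if R ω then w ω else 0) / Z := by
    rw [rcMeasure_real_eq_sum_div G hp hq B]
    congr 1
  rw [h1, h2, ← mul_div_assoc, hmain, mul_div_assoc, add_div, div_self hZ.ne', mul_div_assoc]

/-- The free, `q = 2` instance: `2 φ⁰_{G,p,2}(e open) = p(1 + φ⁰_{G,p,2}(u ↔ v))` for an edge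
`e = ⟨u,v⟩`. [cite: Grimmett2006, Thm. (1.13)(b) and Thm. (1.16) (q = 2)] -/
theorem two_mul_rcMeasure_real_edgeOpen_eq_of_adj {p : ℝ} (hp : p ∈ Set.Icc (0 : ℝ) 1) {u v : V}
    (huv : G.Adj u v) :
    2 * (rcMeasure G p 2 ∅).real {ω | s(u, v) ∈ ω} = p * (1 + (rcMeasure G p 2 ∅).real (openConn u v)) := by
  have h := rcMeasure_real_edgeOpen_eq_of_adj G hp two_pos ∅ huv
  simp only [wired_empty, sup_bot_eq] at h
  rw [h, show (2 : ℝ) - 1 = 1 by norm_num, one_mul]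
  rfl

end OneEdge

/-! ### The plus-boundary two-point Edwards–Sokal identity on a box -/

section PlusPair

variable {V : Type*} [Fintype V] [DecidableEq V]

/-- If `x ↔ y` through open edges of `ω` and the wired set, every plus/cluster-constant
configuration has `σ_x σ_y = 1`: `∑_σ 1{σ = 1 on W} 1_F(σ,ω) σ_xσ_y = 2^{k^W(ω) - 1}`.
[cite: Grimmett2006, §1.4 Thm. 1.16 (proof) and §4.2 eq. (4.12)] -/
theorem sum_boole_plus_bondSpin_mul_spinPair_of_reachable (ω : Finset (Sym2 V)) {W : Set V}
    [DecidablePred (· ∈ W)] (hWne : W.Nonempty) {x y : V}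
    (hxy : (openGraph (↑ω : BondConfig V) ⊔ wired W).Reachable x y) :
    ∑ σ : SpinConfig V, (if (∀ w ∈ W, σ w = 1) ∧ ∀ e ∈ ω, bondSpin σ e = 1 then (1 : ℝ) else 0) *
        spinPair x y σ = (2 : ℝ) ^ (clusterCount (↑ω : BondConfig V) W - 1) := by
  classical
  rw [← sum_boole_plus_bondSpin_eq ω hWne]
  refine Finset.sum_congr rfl fun σ _ => ?_
  split_ifs with h
  · have hσ : σ x = σ y :=
      apply_eq_of_reachable (fun a b hab => apply_eq_of_adj_wired h.1 h.2 hab) hxy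
    have hσ' : spinAt x σ = spinAt y σ := by simp [spinAt, hσ]
    rw [one_mul, spinPair, hσ', spinAt_mul_self]
  · rw [zero_mul]

/-- The flip: if the open cluster of `x` avoids the wired set and `y`, flipping it is an involution
of the plus/cluster-constant configurations reversing `σ_xσ_y`, so
`∑_σ 1{σ = 1 on W} 1_F(σ,ω) σ_xσ_y = 0`. [cite: Grimmett2006, §1.4 Thm. 1.16 (proof) and §4.2] -/
theorem sum_boole_plus_bondSpin_mul_spinPair_of_not_reachable_left (ω : Finset (Sym2 V))
    {W : Set V} [DecidablePred (· ∈ W)] {x y : V}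
    (hxW : ∀ w ∈ W, ¬ (openGraph (↑ω : BondConfig V) ⊔ wired W).Reachable x w)
    (hxy : ¬ (openGraph (↑ω : BondConfig V) ⊔ wired W).Reachable x y) :
    ∑ σ : SpinConfig V, (if (∀ w ∈ W, σ w = 1) ∧ ∀ e ∈ ω, bondSpin σ e = 1 then (1 : ℝ) else 0) *
        spinPair x y σ = 0 := by
  classical
  set H : SimpleGraph V := openGraph (↑ω : BondConfig V) ⊔ wired W with hH
  set φ : SpinConfig V → SpinConfig V := fun σ v => if H.Reachable x v then -σ v else σ v with hφ
  have hφi : Function.Involutive φ := by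
    intro σ
    funext v
    by_cases hv : H.Reachable x v <;> simp [φ, hv]
  have key : ∀ {a b : V}, H.Adj a b → (H.Reachable x a ↔ H.Reachable x b) := fun hab =>
    ⟨fun h => h.trans hab.reachable, fun h => h.trans hab.symm.reachable⟩
  have hWfix : ∀ σ : SpinConfig V, ∀ w ∈ W, φ σ w = σ w := by
    intro σ w hw
    simp only [hφ, hxW w hw, if_false]
  have hF : ∀ σ : SpinConfig V, (∀ e ∈ ω, bondSpin (φ σ) e = 1) ↔ ∀ e ∈ ω, bondSpin σ e = 1 := by
    intro σ
    rw [forall_bondSpin_eq_one_iff, forall_bondSpin_eq_one_iff]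
    have hAdj : ∀ {a b : V}, (openGraph (↑ω : BondConfig V)).Adj a b → H.Adj a b :=
      fun hab => (sup_adj _ _ _ _).2 (Or.inl hab)
    constructor
    · intro h a b hab
      have hab' := h hab
      by_cases ha : H.Reachable x a
      · have hb : H.Reachable x b := (key (hAdj hab)).1 ha
        simp only [φ, if_pos ha, if_pos hb, neg_inj] at hab'
        exact hab'
      · have hb : ¬ H.Reachable x b := fun hb => ha ((key (hAdj hab)).2 hb)
        simp only [φ, if_neg ha, if_neg hb] at hab'
        exact hab'
    · intro h a b hab
      by_cases ha : H.Reachable x a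
      · have hb : H.Reachable x b := (key (hAdj hab)).1 ha
        simp only [φ, if_pos ha, if_pos hb, h hab]
      · have hb : ¬ H.Reachable x b := fun hb => ha ((key (hAdj hab)).2 hb)
        simp only [φ, if_neg ha, if_neg hb, h hab]
  have hP : ∀ σ : SpinConfig V, ((∀ w ∈ W, φ σ w = 1) ∧ ∀ e ∈ ω, bondSpin (φ σ) e = 1) ↔
      ((∀ w ∈ W, σ w = 1) ∧ ∀ e ∈ ω, bondSpin σ e = 1) := by
    intro σ
    rw [hF σ]
    refine and_congr_left fun _ => ?_
    exact forall₂_congr fun w hw => by rw [hWfix σ w hw]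
  have hsp : ∀ σ : SpinConfig V, spinPair x y (φ σ) = -spinPair x y σ := by
    intro σ
    simp only [spinPair, spinAt, φ, if_pos (Reachable.refl x), if_neg hxy, Units.val_neg,
      Int.cast_neg, neg_mul]
  have hS := (Fintype.sum_equiv (Function.Involutive.toPerm φ hφi)
    (fun σ => (if (∀ w ∈ W, φ σ w = 1) ∧ ∀ e ∈ ω, bondSpin (φ σ) e = 1 then (1 : ℝ) else 0) *
      spinPair x y (φ σ))
    (fun σ => (if (∀ w ∈ W, σ w = 1) ∧ ∀ e ∈ ω, bondSpin σ e = 1 then (1 : ℝ) else 0) * spinPair x y σ)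
    fun σ => rfl)
  simp_rw [hP, hsp, mul_neg, Finset.sum_neg_distrib] at hS
  linarith

/-- If `x ↮ y` (through open edges and the wired set), then `∑_σ 1{σ = 1 on W} 1_F(σ,ω) σ_xσ_y = 0`:
at most one of `x`, `y` is joined to the wired set, and the open cluster of the other one is
flipped. [cite: Grimmett2006, §1.4 Thm. 1.16 (proof) and §4.2] -/
theorem sum_boole_plus_bondSpin_mul_spinPair_of_not_reachable (ω : Finset (Sym2 V))
    {W : Set V} [DecidablePred (· ∈ W)] {x y : V}
    (hxy : ¬ (openGraph (↑ω : BondConfig V) ⊔ wired W).Reachable x y) :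
    ∑ σ : SpinConfig V, (if (∀ w ∈ W, σ w = 1) ∧ ∀ e ∈ ω, bondSpin σ e = 1 then (1 : ℝ) else 0) *
        spinPair x y σ = 0 := by
  set H : SimpleGraph V := openGraph (↑ω : BondConfig V) ⊔ wired W with hH
  by_cases hxW : ∀ w ∈ W, ¬ H.Reachable x w
  · exact sum_boole_plus_bondSpin_mul_spinPair_of_not_reachable_left ω hxW hxy
  · push Not at hxW
    obtain ⟨w₁, hw₁, hxw₁⟩ := hxW
    have hyW : ∀ w ∈ W, ¬ H.Reachable y w := by
      intro w₂ hw₂ hyw₂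
      apply hxy
      refine hxw₁.trans (Reachable.trans ?_ hyw₂.symm)
      by_cases h12 : w₁ = w₂
      · rw [h12]
      · exact Adj.reachable ((sup_adj _ _ _ _).2 (Or.inr ((wired_adj W w₁ w₂).2 ⟨h12, hw₁, hw₂⟩)))
    have hyx : ¬ H.Reachable y x := fun h => hxy h.symm
    have h := sum_boole_plus_bondSpin_mul_spinPair_of_not_reachable_left ω hyW hyx
    have hcomm : ∀ σ : SpinConfig V, spinPair y x σ = spinPair x y σ := fun σ => mul_comm _ _
    simp_rw [hcomm] at h
    exact h

end PlusPair

section PlusPairBox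

variable {d n : ℕ}

/-- Exchange of the configuration sum and the edge-set sum, with the plus constraint (local copy
of the bookkeeping identity of `IsingPlusEdwardsSokal.lean`). [cite: Grimmett2006, §1.4 Thm. 1.16 (proof)] -/
private theorem sum_ite_mul_sum_exchange' {ι κ : Type*} [Fintype ι] (t : Finset κ) (c : ℝ)
    (Wt : κ → ℝ) (P : ι → Prop) [DecidablePred P] (Fc : ι → κ → Prop) [∀ i k, Decidable (Fc i k)]
    (s : ι → ℝ) :
    ∑ i, (if P i then (c * ∑ k ∈ t, Wt k * (if Fc i k then 1 else 0)) * s i else 0) =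
      c * ∑ k ∈ t, Wt k * ∑ i, (if P i ∧ Fc i k then (1 : ℝ) else 0) * s i := by
  have step : ∀ i, (if P i then (c * ∑ k ∈ t, Wt k * (if Fc i k then 1 else 0)) * s i else 0) =
      ∑ k ∈ t, c * (Wt k * ((if P i ∧ Fc i k then (1 : ℝ) else 0) * s i)) := by
    intro i
    by_cases hP : P i
    · simp only [hP, if_true, true_and, Finset.mul_sum, Finset.sum_mul]
      refine Finset.sum_congr rfl fun k _ => ?_
      ring
    · simp only [hP, if_false, false_and, zero_mul, mul_zero, Finset.sum_const_zero]
  calc ∑ i, (if P i then (c * ∑ k ∈ t, Wt k * (if Fc i k then 1 else 0)) * s i else 0)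
      = ∑ i, ∑ k ∈ t, c * (Wt k * ((if P i ∧ Fc i k then (1 : ℝ) else 0) * s i)) :=
        Finset.sum_congr rfl fun i _ => step i
    _ = ∑ k ∈ t, ∑ i, c * (Wt k * ((if P i ∧ Fc i k then (1 : ℝ) else 0) * s i)) := Finset.sum_comm
    _ = c * ∑ k ∈ t, Wt k * ∑ i, (if P i ∧ Fc i k then (1 : ℝ) else 0) * s i := by
        rw [Finset.mul_sum]
        refine Finset.sum_congr rfl fun k _ => ?_
        rw [Finset.mul_sum, Finset.mul_sum]

/-- **Edwards–Sokal with plus boundary conditions, two-point function** (Grimmett 2006, Thm. 1.16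
and §4.2, (4.12), for `q = 2` with Ising spins `±1`; Edwards–Sokal 1988): for `β ≥ 0`, `d ≥ 1` and
two distinct points `x, y` of the closed box `Λ_{n+1} ⊆ ℤ^d` (spins on `∂Λ_{n+1} = Λ_{n+1} ∖ Λ_n`
being the boundary spins `+1`), the plus-boundary two-point function `⟨σ_xσ_y⟩⁺_{Λ_n;β,0}` of the
volume `Λ_n` equals the probability, under the random-cluster measure with
`p = 1 - e^{-2β}`, `q = 2` of the spanning graph of the closed box `Λ_{n+1}` with edge set
`ℰ^b_{Λ_n}` wired on `∂Λ_{n+1}`, that `x` and `y` are joined by an open path, passage through the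
wired boundary being allowed: `⟨σ_xσ_y⟩⁺_{Λ_n;β,0} = φ^{∂Λ_{n+1}}_{⟨ℰ^b⟩,p,2}(x ↔ y)`.
[cite: Grimmett2006, Thm. 1.16 and §4.2 eq. (4.12); EdwardsSokal1988] -/
theorem isingCorr_plus_box_pair_eq_rcMeasure_real (hd : 0 < d) {β : ℝ} (hβ : 0 ≤ β) (n : ℕ)
    {x y : Site d} (hx : x ∈ box d (n + 1)) (hy : y ∈ box d (n + 1)) (hxy : x ≠ y) :
    isingCorr (zdGraph d) (box d n) β 0 .plus {x, y} =
      (rcMeasure (touchGraph d n) (fkIsingParam β) 2 (boxBoundary d (n + 1))).real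
        {ω | (openGraph ω ⊔ wired (boxBoundary d (n + 1))).Reachable ⟨x, hx⟩ ⟨y, hy⟩} := by
  classical
  set W := boxBoundary d (n + 1) with hW
  set x' : BoxV d (n + 1) := ⟨x, hx⟩ with hx'
  set y' : BoxV d (n + 1) := ⟨y, hy⟩ with hy'
  set T := touchEdges d n with hT
  set p := fkIsingParam β with hpdef
  set A : Set (BondConfig (BoxV d (n + 1))) :=
    {ω | (openGraph ω ⊔ wired W).Reachable x' y'} with hA
  have hWne : W.Nonempty := by
    obtain ⟨z, hz⟩ := innerBoundary_box_nonempty hd (n + 1)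
    exact ⟨⟨z, (mem_innerBoundary_iff.1 hz).1⟩, hz⟩
  have hp : p ∈ Set.Icc (0 : ℝ) 1 := fkIsingParam_mem_Icc hβ
  have hq : (0 : ℝ) < 2 := two_pos
  have hET : (touchGraph d n).edgeFinset = T := edgeFinset_touchGraph
  have hc : (0 : ℝ) < Real.exp β ^ #T := pow_pos (Real.exp_pos β) _
  -- the weights
  set Wt : Finset (Sym2 (BoxV d (n + 1))) → ℝ := fun ω => p ^ #ω * (1 - p) ^ #(T \ ω) with hWt
  set K : Finset (Sym2 (BoxV d (n + 1))) → ℕ :=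
    fun ω => clusterCount (↑ω : BondConfig (BoxV d (n + 1))) W with hK
  haveI : Nonempty (BoxV d (n + 1)) := ⟨boxOrigin d (n + 1)⟩
  have h2K : ∀ ω, (2 : ℝ) ^ K ω = 2 * 2 ^ (K ω - 1) := by
    intro ω
    have hpos : 0 < K ω := clusterCount_pos _ _
    conv_lhs => rw [show K ω = (K ω - 1) + 1 by omega, pow_succ]
    ring
  -- the Ising side as a ratio of finite sums over interior configurations
  have hspin : spinProduct ({x, y} : Finset (Site d)) = spinPair x y := spinProduct_pair_eq_spinPair hxy
  have hL : isingCorr (zdGraph d) (box d n) β 0 .plus {x, y} =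
      (∑ τ : ↥(box d n) → ℤˣ, isingWeight (zdGraph d) (box d n) β 0 .plus τ *
          spinPair x y (glue (box d n) τ .plus)) /
        ∑ τ : ↥(box d n) → ℤˣ, isingWeight (zdGraph d) (box d n) β 0 .plus τ := by
    rw [isingCorr, isingExpect, hspin, integral_isingMeasure _ _ _ _ _ (measurable_spinPair x y),
      isingPartitionFunction]
  -- both sums transferred to the closed box and expanded over edge sets
  have hexp : ∀ σ : SpinConfig (BoxV d (n + 1)), Real.exp (β * ∑ e ∈ T, bondSpin σ e) =
      Real.exp β ^ #T * ∑ ω ∈ T.powerset, Wt ω * (if ∀ e ∈ ω, bondSpin σ e = 1 then 1 else 0) := by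
    intro σ
    have h := exp_mul_sum_bondSpin_eq (touchGraph d n) β σ
    rw [hET] at h
    rw [h]
  have hpair : ∀ τ : ↥(box d n) → ℤˣ,
      spinPair x y (glue (box d n) τ .plus) = spinPair x' y' (plusExt d n τ) := by
    intro τ
    rw [spinPair, spinPair, show x = x'.1 from rfl, show y = y'.1 from rfl, spinAt_glue_plus,
      spinAt_glue_plus]
  have hNum : ∑ τ : ↥(box d n) → ℤˣ, isingWeight (zdGraph d) (box d n) β 0 .plus τ *
        spinPair x y (glue (box d n) τ .plus) =
      Real.exp β ^ #T * ∑ ω ∈ T.powerset, Wt ω *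
        ∑ σ : SpinConfig (BoxV d (n + 1)),
          (if (∀ w ∈ W, σ w = 1) ∧ ∀ e ∈ ω, bondSpin σ e = 1 then (1 : ℝ) else 0) * spinPair x' y' σ := by
    have h1 : ∀ τ : ↥(box d n) → ℤˣ, isingWeight (zdGraph d) (box d n) β 0 .plus τ *
          spinPair x y (glue (box d n) τ .plus) =
        (fun σ => Real.exp (β * ∑ e ∈ T, bondSpin σ e) * spinPair x' y' σ) (plusExt d n τ) := by
      intro τ
      simp only [isingWeight_plus_box_eq, ← hT, hpair τ]
    simp_rw [h1]
    have h2 := sum_plusExt_eq (d := d) (n := n)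
      (fun σ => Real.exp (β * ∑ e ∈ T, bondSpin σ e) * spinPair x' y' σ)
    rw [h2]
    simp_rw [hexp]
    exact sum_ite_mul_sum_exchange' _ _ _ _ _ _
  have hDen : ∑ τ : ↥(box d n) → ℤˣ, isingWeight (zdGraph d) (box d n) β 0 .plus τ =
      Real.exp β ^ #T * ∑ ω ∈ T.powerset, Wt ω *
        ∑ σ : SpinConfig (BoxV d (n + 1)),
          (if (∀ w ∈ W, σ w = 1) ∧ ∀ e ∈ ω, bondSpin σ e = 1 then (1 : ℝ) else 0) * 1 := by
    have h1 : ∀ τ : ↥(box d n) → ℤˣ, isingWeight (zdGraph d) (box d n) β 0 .plus τ =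
        (fun σ => Real.exp (β * ∑ e ∈ T, bondSpin σ e) * 1) (plusExt d n τ) := by
      intro τ
      simp only [isingWeight_plus_box_eq, ← hT, mul_one]
    simp_rw [h1]
    have h2 := sum_plusExt_eq (d := d) (n := n) (fun σ => Real.exp (β * ∑ e ∈ T, bondSpin σ e) * 1)
    rw [h2]
    simp_rw [hexp]
    exact sum_ite_mul_sum_exchange' _ _ _ _ _ (fun _ => 1)
  -- evaluate the configuration sums
  have hNum' : ∑ τ : ↥(box d n) → ℤˣ, isingWeight (zdGraph d) (box d n) β 0 .plus τ *
        spinPair x y (glue (box d n) τ .plus) =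
      Real.exp β ^ #T * ∑ ω ∈ T.powerset, Wt ω * ((2 : ℝ) ^ (K ω - 1) *
        (if (↑ω : BondConfig (BoxV d (n + 1))) ∈ A then 1 else 0)) := by
    rw [hNum]
    refine congrArg (Real.exp β ^ #T * ·) (Finset.sum_congr rfl fun ω _ => ?_)
    refine congrArg (Wt ω * ·) ?_
    by_cases hAω : (↑ω : BondConfig (BoxV d (n + 1))) ∈ A
    · rw [if_pos hAω, mul_one]
      exact sum_boole_plus_bondSpin_mul_spinPair_of_reachable ω hWne hAω
    · rw [if_neg hAω, mul_zero]
      exact sum_boole_plus_bondSpin_mul_spinPair_of_not_reachable ω hAω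
  have hDen' : ∑ τ : ↥(box d n) → ℤˣ, isingWeight (zdGraph d) (box d n) β 0 .plus τ =
      Real.exp β ^ #T * ∑ ω ∈ T.powerset, Wt ω * (2 : ℝ) ^ (K ω - 1) := by
    rw [hDen]
    refine congrArg (Real.exp β ^ #T * ·) (Finset.sum_congr rfl fun ω _ => ?_)
    refine congrArg (Wt ω * ·) ?_
    simp only [mul_one]
    exact sum_boole_plus_bondSpin_eq ω hWne
  -- the random-cluster side
  have hR : (rcMeasure (touchGraph d n) p 2 W).real A =
      (∑ ω ∈ T.powerset, if (↑ω : BondConfig (BoxV d (n + 1))) ∈ A then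
          Wt ω * (2 : ℝ) ^ K ω else 0) /
        ∑ ω ∈ T.powerset, Wt ω * (2 : ℝ) ^ K ω := by
    have hw : ∀ ω, rcWeight (touchGraph d n) p 2 W ω = Wt ω * (2 : ℝ) ^ K ω := by
      intro ω
      rw [rcWeight, hET]
    rw [rcMeasure_real_eq_sum_div _ hp hq, rcPartitionFunction, hET]
    simp only [hw]
  -- compare
  rw [hL, hNum', hDen', mul_div_mul_left _ _ hc.ne', hR]
  have e1 : ∑ ω ∈ T.powerset, (if (↑ω : BondConfig (BoxV d (n + 1))) ∈ A then
        Wt ω * (2 : ℝ) ^ K ω else 0) =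
      2 * ∑ ω ∈ T.powerset, Wt ω * ((2 : ℝ) ^ (K ω - 1) *
        (if (↑ω : BondConfig (BoxV d (n + 1))) ∈ A then 1 else 0)) := by
    rw [Finset.mul_sum]
    refine Finset.sum_congr rfl fun ω _ => ?_
    rw [h2K]
    split_ifs <;> ring
  have e2 : ∑ ω ∈ T.powerset, Wt ω * (2 : ℝ) ^ K ω = 2 * ∑ ω ∈ T.powerset, Wt ω * (2 : ℝ) ^ (K ω - 1) := by
    rw [Finset.mul_sum]
    refine Finset.sum_congr rfl fun ω _ => ?_
    rw [h2K]
    ring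
  rw [e1, e2, mul_div_mul_left _ _ (two_ne_zero)]

end PlusPairBox

/-! ### The dictionary in finite volume -/

section FiniteVolume

variable {d : ℕ}

/-- For a pair of points of the piece `S`, the event `eOpen S s(x,y)` is "the edge `⟨x,y⟩` of `S`
is open". [cite: Grimmett2006, (4.61) (J_e)] -/
theorem eOpen_mk_eq_setOf {S : Finset (Site d)} {x y : Site d} (hx : x ∈ S) (hy : y ∈ S) :
    eOpen S s(x, y) = {ω | s((⟨x, hx⟩ : ↥S), ⟨y, hy⟩) ∈ ω} :=
  Set.ext fun ω => mem_eOpen_mk_iff hx hy ω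

/-- An edge of `ℤ^d` lives in dimension `d ≥ 1`. [folklore] -/
private theorem dim_pos_of_zdGraph_adj {x y : Site d} (hxy : (zdGraph d).Adj x y) : 0 < d := by
  obtain ⟨i, -⟩ := (zdGraph_adj_iff x y).1 hxy
  exact i.pos

/-- **Finite-volume dictionary, free boundary condition** (Grimmett 2006, Thm. (1.13)(b) with
Thm. (1.16), `q = 2`): for `β ≥ 0`, `p = 1 - e^{-2β}` and neighbours `x ∼ y` in the box `Λ_N`,
`φ⁰_{Λ_N,p,2}(⟨x,y⟩ open) = p (1 + ⟨σ_xσ_y⟩^∅_{Λ_N;β,0}) / 2`.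
[cite: Grimmett2006, Thm. (1.13)(b) and Thm. (1.16); EdwardsSokal1988] -/
theorem boxFreeEdgeProb_two_eq {β : ℝ} (hβ : 0 ≤ β) {N : ℕ} {x y : Site d} (hx : x ∈ box d N)
    (hy : y ∈ box d N) (hxy : (zdGraph d).Adj x y) :
    boxFreeEdgeProb d (fkIsingParam β) 2 s(x, y) N =
      fkIsingParam β * (1 + isingCorr (zdGraph d) (box d N) β 0 .free {x, y}) / 2 := by
  classical
  set GΛ : SimpleGraph ↥(box d N) := finsetGraph (zdGraph d) (box d N) with hGΛ
  set x' : ↥(box d N) := ⟨x, hx⟩ with hx'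
  set y' : ↥(box d N) := ⟨y, hy⟩ with hy'
  have hp : fkIsingParam β ∈ Set.Icc (0 : ℝ) 1 := fkIsingParam_mem_Icc hβ
  have hadj : GΛ.Adj x' y' := hxy
  -- the one-edge identity, free, `q = 2`
  have h1 : 2 * (rcMeasure GΛ (fkIsingParam β) 2 ∅).real {ω | s(x', y') ∈ ω} =
      fkIsingParam β * (1 + (rcMeasure GΛ (fkIsingParam β) 2 ∅).real (openConn x' y')) :=
    two_mul_rcMeasure_real_edgeOpen_eq_of_adj GΛ hp hadj
  -- the free two-point Edwards–Sokal identity on the finite graph `(Λ_N, E_{Λ_N})`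
  have h2 : (rcMeasure GΛ (fkIsingParam β) 2 ∅).real (openConn x' y') =
      isingTwoPoint GΛ univ β 0 .free x' y' :=
    (edwardsSokal_twoPoint_holds GΛ hβ x' y').symm
  -- transported to the box of `ℤ^d`
  set ι : ↥(box d N) ↪ Site d := Function.Embedding.subtype (· ∈ box d N) with hι
  have hmap : (univ : Finset ↥(box d N)).map ι = box d N := by
    rw [hι, Finset.univ_eq_attach, Finset.attach_map_val]
  have hadjι : ∀ a ∈ (univ : Finset ↥(box d N)), ∀ b ∈ (univ : Finset ↥(box d N)),
      ((zdGraph d).Adj (ι a) (ι b) ↔ GΛ.Adj a b) := fun _ _ _ _ => Iff.rfl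
  have h3 : isingTwoPoint GΛ univ β 0 .free x' y' =
      isingTwoPoint (zdGraph d) (box d N) β 0 .free x y := by
    have h := isingTwoPoint_free_map (G := GΛ) (G' := zdGraph d) ι (Λ := univ) hadjι β 0 x' y'
    rw [hmap] at h
    exact h.symm
  have h4 : isingTwoPoint (zdGraph d) (box d N) β 0 .free x y =
      isingCorr (zdGraph d) (box d N) β 0 .free {x, y} := by
    rw [isingTwoPoint, isingCorr, spinProduct_pair_eq_spinPair hxy.ne]
  rw [boxFreeEdgeProb, freeEdgeProb, eOpen_mk_eq_setOf hx hy, ← h4, ← h3, ← h2]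
  linarith

/-- **Finite-volume dictionary, wired/plus boundary condition** (Grimmett 2006, Thm. (1.13)(b)
with Thm. (1.16) and §4.2 (4.12)–(4.13), `q = 2`): for `β ≥ 0`, `p = 1 - e^{-2β}` and neighbours
`x ∼ y` in the box `Λ_n`, `φ¹_{Λ_{n+1},p,2}(⟨x,y⟩ open) = p (1 + ⟨σ_xσ_y⟩⁺_{Λ_n;β,0}) / 2`
(the wired measure of `Λ_{n+1}` with `∂Λ_{n+1}` wired; its ring edges are integrated out by the
domain Markov property, `rcMeasure_real_eq_fromEdgeSet_of_outside_wired`).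
[cite: Grimmett2006, Thm. (1.13)(b), Thm. (1.16) and §4.2 eqs. (4.12)–(4.13); EdwardsSokal1988] -/
theorem boxWiredEdgeProb_two_succ_eq {β : ℝ} (hβ : 0 ≤ β) {n : ℕ} {x y : Site d}
    (hx : x ∈ box d n) (hy : y ∈ box d n) (hxy : (zdGraph d).Adj x y) :
    boxWiredEdgeProb d (fkIsingParam β) 2 s(x, y) (n + 1) =
      fkIsingParam β * (1 + isingCorr (zdGraph d) (box d n) β 0 .plus {x, y}) / 2 := by
  classical
  have hd : 0 < d := dim_pos_of_zdGraph_adj hxy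
  have hp : fkIsingParam β ∈ Set.Icc (0 : ℝ) 1 := fkIsingParam_mem_Icc hβ
  have hx1 : x ∈ box d (n + 1) := box_mono d (Nat.le_succ n) hx
  have hy1 : y ∈ box d (n + 1) := box_mono d (Nat.le_succ n) hy
  set x' : BoxV d (n + 1) := ⟨x, hx1⟩ with hx'
  set y' : BoxV d (n + 1) := ⟨y, hy1⟩ with hy'
  set W : Set (BoxV d (n + 1)) := boxBoundary d (n + 1) with hW
  have hne : x' ≠ y' := fun h => hxy.ne (congrArg Subtype.val h)
  have he'T : s(x', y') ∈ touchEdges d n := by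
    rw [touchEdges, Finset.mem_filter, mem_edgeFinset]
    exact ⟨hxy, x', Sym2.mem_mk_left _ _, hx⟩
  have hadj : (touchGraph d n).Adj x' y' := by
    rw [touchGraph, fromEdgeSet_adj]
    exact ⟨Finset.mem_coe.2 he'T, hne⟩
  -- the ring edges of `Λ_{n+1}` are integrated out
  have hstep : boxWiredEdgeProb d (fkIsingParam β) 2 s(x, y) (n + 1) =
      (rcMeasure (touchGraph d n) (fkIsingParam β) 2 W).real {ω | s(x', y') ∈ ω} := by
    rw [boxWiredEdgeProb, wiredEdgeProb, eOpen_mk_eq_setOf hx1 hy1]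
    change (rcMeasure (boxGraph d (n + 1)) (fkIsingParam β) 2 W).real {ω | s(x', y') ∈ ω} = _
    have h := rcMeasure_real_eq_fromEdgeSet_of_outside_wired (boxGraph d (n + 1)) hp two_pos
      W (touchEdges d n) touchEdges_subset ?_ (A := {ω | s(x', y') ∈ ω}) ?_
    · rw [h]
      unfold touchGraph
      congr!
    · intro e he heT z hz
      rw [hW, mem_boxBoundary_iff_notMem]
      intro hzn
      exact heT (by rw [touchEdges, Finset.mem_filter]; exact ⟨he, z, hz, hzn⟩)
    · intro ω _
      simp only [Set.mem_setOf_eq, Finset.mem_coe, Finset.mem_inter, he'T, and_true]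
  -- the one-edge identity on the touch graph and the plus two-point Edwards–Sokal identity
  have h1 := rcMeasure_real_edgeOpen_eq_of_adj (touchGraph d n) hp two_pos W hadj
  have h2 : isingCorr (zdGraph d) (box d n) β 0 .plus {x, y} =
      (rcMeasure (touchGraph d n) (fkIsingParam β) 2 W).real
        {ω | (openGraph ω ⊔ wired W).Reachable x' y'} :=
    isingCorr_plus_box_pair_eq_rcMeasure_real hd hβ n hx1 hy1 hxy.ne
  rw [hstep, h2]
  rw [show (2 : ℝ) - 1 = 1 by norm_num, one_mul] at h1
  linarith

end FiniteVolume

/-! ### The dictionary in infinite volume -/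

section InfiniteVolume

variable {d : ℕ}

/-- **The free edge density of FK–Ising is a free nearest-neighbour energy** (Grimmett 2006,
Thm. (4.91)(b), `q = 2`, free boundary condition; finite volume Thm. (1.13)(b)/(1.16), limits
along boxes (4.61) and Friedli–Velenik Exercise 3.16): for `β ≥ 0`, `p = 1 - e^{-2β}` and
neighbours `x ∼ y` of `ℤ^d`, `h⁰(p,2) = p (1 + ⟨σ_xσ_y⟩^∅_{β,0}) / 2`.
[cite: Grimmett2006, Thm. (4.91)(b) with (4.61), Thm. (1.13)(b) and Thm. (1.16)] -/
theorem freeEdgeDensity_two_eq {β : ℝ} (hβ : 0 ≤ β) {x y : Site d} (hxy : (zdGraph d).Adj x y) :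
    freeEdgeDensity d (fkIsingParam β) 2 s(x, y) =
      fkIsingParam β * (1 + freeCorr d β 0 {x, y}) / 2 := by
  have hp : fkIsingParam β ∈ Set.Icc (0 : ℝ) 1 := fkIsingParam_mem_Icc hβ
  have h1 : Tendsto (fun N => boxFreeEdgeProb d (fkIsingParam β) 2 s(x, y) N) atTop
      (𝓝 (freeEdgeDensity d (fkIsingParam β) 2 s(x, y))) :=
    tendsto_boxFreeEdgeProb hp (by norm_num) _
  have h2 : Tendsto (fun N => isingCorr (zdGraph d) (box d N) β 0 .free {x, y}) atTop
      (𝓝 (freeCorr d β 0 {x, y})) :=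
    hasBoxLimit_isingCorr_free_holds hβ le_rfl {x, y}
  have h3 : Tendsto (fun N => fkIsingParam β * (1 + isingCorr (zdGraph d) (box d N) β 0 .free {x, y}) / 2)
      atTop (𝓝 (fkIsingParam β * (1 + freeCorr d β 0 {x, y}) / 2)) :=
    ((h2.const_add 1).const_mul _).div_const 2
  have heq : (fun N => fkIsingParam β * (1 + isingCorr (zdGraph d) (box d N) β 0 .free {x, y}) / 2)
      =ᶠ[atTop] fun N => boxFreeEdgeProb d (fkIsingParam β) 2 s(x, y) N := by
    filter_upwards [eventually_ge_atTop (max (siteRad x) (siteRad y))] with N hN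
    exact (boxFreeEdgeProb_two_eq hβ (mem_box_iff_siteRad_le.2 (le_of_max_le_left hN))
      (mem_box_iff_siteRad_le.2 (le_of_max_le_right hN)) hxy).symm
  exact tendsto_nhds_unique h1 (h3.congr' heq)

/-- **The wired edge density of FK–Ising is a plus nearest-neighbour energy** (Grimmett 2006,
Thm. (4.91)(b), `q = 2`, wired boundary condition; finite volume Thm. (1.13)(b)/(1.16) with
§4.2 (4.12)–(4.13), limits along boxes (4.61) and Friedli–Velenik Thm. 3.17): for `β ≥ 0`,
`p = 1 - e^{-2β}` and neighbours `x ∼ y` of `ℤ^d`, `h¹(p,2) = p (1 + ⟨σ_xσ_y⟩⁺_{β,0}) / 2`.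
[cite: Grimmett2006, Thm. (4.91)(b) with (4.61), Thm. (1.16) and §4.2 eqs. (4.12)–(4.13)] -/
theorem wiredEdgeDensity_two_eq {β : ℝ} (hβ : 0 ≤ β) {x y : Site d} (hxy : (zdGraph d).Adj x y) :
    wiredEdgeDensity d (fkIsingParam β) 2 s(x, y) =
      fkIsingParam β * (1 + plusCorr d β 0 {x, y}) / 2 := by
  have hd : 0 < d := dim_pos_of_zdGraph_adj hxy
  have hp : fkIsingParam β ∈ Set.Icc (0 : ℝ) 1 := fkIsingParam_mem_Icc hβ
  have h1 : Tendsto (fun n : ℕ => boxWiredEdgeProb d (fkIsingParam β) 2 s(x, y) (n + 1)) atTop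
      (𝓝 (wiredEdgeDensity d (fkIsingParam β) 2 s(x, y))) :=
    (tendsto_boxWiredEdgeProb hd hp (by norm_num) _).comp (tendsto_add_atTop_nat 1)
  have h2 : Tendsto (fun n => isingCorr (zdGraph d) (box d n) β 0 .plus {x, y}) atTop
      (𝓝 (plusCorr d β 0 {x, y})) :=
    hasBoxLimit_isingCorr_plus_holds hβ le_rfl {x, y}
  have h3 : Tendsto (fun n => fkIsingParam β * (1 + isingCorr (zdGraph d) (box d n) β 0 .plus {x, y}) / 2)
      atTop (𝓝 (fkIsingParam β * (1 + plusCorr d β 0 {x, y}) / 2)) :=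
    ((h2.const_add 1).const_mul _).div_const 2
  have heq : (fun n => fkIsingParam β * (1 + isingCorr (zdGraph d) (box d n) β 0 .plus {x, y}) / 2)
      =ᶠ[atTop] fun n : ℕ => boxWiredEdgeProb d (fkIsingParam β) 2 s(x, y) (n + 1) := by
    filter_upwards [eventually_ge_atTop (max (siteRad x) (siteRad y))] with n hn
    exact (boxWiredEdgeProb_two_succ_eq hβ (mem_box_iff_siteRad_le.2 (le_of_max_le_left hn))
      (mem_box_iff_siteRad_le.2 (le_of_max_le_right hn)) hxy).symm
  exact tendsto_nhds_unique h1 (h3.congr' heq)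

/-- **Equal nearest-neighbour energies give equal edge densities** (Grimmett 2006, Thm. (4.91)(b)
read at `q = 2` through the dictionary, with the automorphism invariance (4.61) of `h⁰, h¹`): if
`⟨σ_0σ_{eᵢ}⟩^∅_{β,0} = ⟨σ_0σ_{eᵢ}⟩⁺_{β,0}` for one direction `i`, then `h⁰(p,2) = h¹(p,2)` at
every edge of `ℤ^d`, `p = 1 - e^{-2β}` — the hypothesis `hgood` of
`iInf_boxWiredReal_le_iSup_boxFreeReal` (Grimmett 2006, Thm. (4.63), (c) ⇒ (d)).
[cite: Grimmett2006, Thm. (4.91)(b), (4.61) and Thm. (4.63)] -/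
theorem freeEdgeDensity_eq_wiredEdgeDensity_of_nn_freeCorr_eq_plusCorr {β : ℝ} (hβ : 0 ≤ β)
    (i : Fin d) (h : freeCorr d β 0 {0, Pi.single i 1} = plusCorr d β 0 {0, Pi.single i 1})
    {e : Sym2 (Site d)} (he : e ∈ (zdGraph d).edgeSet) :
    freeEdgeDensity d (fkIsingParam β) 2 e = wiredEdgeDensity d (fkIsingParam β) 2 e := by
  have hd : 0 < d := i.pos
  have hp : fkIsingParam β ∈ Set.Icc (0 : ℝ) 1 := fkIsingParam_mem_Icc hβ
  have h2 : (1 : ℝ) ≤ 2 := by norm_num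
  -- `{0, eᵢ}` is an edge of `ℤ^d` (also `zdGraph_adj_zero_single` of `HvdHTwoPointStepBound.lean`)
  have hadj : (zdGraph d).Adj (0 : Site d) (Pi.single i 1) :=
    (zdGraph_adj_iff _ _).2 ⟨i, Or.inl (zero_add _).symm⟩
  have he₀ : s((0 : Site d), Pi.single i 1) ∈ (zdGraph d).edgeSet := (mem_edgeSet _).2 hadj
  rw [freeEdgeDensity_eq_of_mem_edgeSet hp h2 he he₀, wiredEdgeDensity_eq_of_mem_edgeSet hd hp h2 he he₀,
    freeEdgeDensity_two_eq hβ hadj, wiredEdgeDensity_two_eq hβ hadj, h]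

/-- **Raoufi's Proposition 1 gives `h⁰(p,2) = h¹(p,2)` at every `p = 1 - e^{-2β}`, `β ≥ 0`,
`d ≥ 1`** (conditional on the tree's named fact `Raoufi2020_nn_freeCorr_eq_plusCorr`, Raoufi 2020,
Prop. 1: `⟨σ_0σ_{eᵢ}⟩⁺_β = ⟨σ_0σ_{eᵢ}⟩^∅_β` on every amenable transitive graph, here `ℤ^d`): the
free and wired FK–Ising edge densities coincide at every parameter, hence (Grimmett 2006,
Thm. (4.63)) so do the free and wired infinite-volume FK–Ising measures.
[cite: Raoufi2020, Prop. 1; Grimmett2006, Thm. (4.91)(b) and Thm. (4.63)] -/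
theorem freeEdgeDensity_eq_wiredEdgeDensity_two_of_raoufi (h : Raoufi2020_nn_freeCorr_eq_plusCorr)
    (hd : 1 ≤ d) {β : ℝ} (hβ : 0 ≤ β) {e : Sym2 (Site d)} (he : e ∈ (zdGraph d).edgeSet) :
    freeEdgeDensity d (fkIsingParam β) 2 e = wiredEdgeDensity d (fkIsingParam β) 2 e :=
  freeEdgeDensity_eq_wiredEdgeDensity_of_nn_freeCorr_eq_plusCorr hβ ⟨0, hd⟩ (h d β hd hβ ⟨0, hd⟩) he

/-- The FK–Ising parameter is positive at positive inverse temperature. [cite: Grimmett2006, §1.4] -/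
theorem fkIsingParam_pos_of_pos {β : ℝ} (hβ : 0 < β) : 0 < fkIsingParam β := by
  have h : Real.exp (-2 * β) < Real.exp 0 := Real.exp_lt_exp.2 (by linarith)
  rw [Real.exp_zero] at h
  exact sub_pos.2 h

/-- **Free = wired edge density iff free = plus nearest-neighbour energy** (`β > 0`, one direction
`i`; Grimmett 2006, Thm. (4.91)(b) at `q = 2` through the dictionary): the FK uniqueness criterion
of Grimmett 2006, Thm. (4.63)(c) and Raoufi's identity are the same statement.
[cite: Grimmett2006, Thm. (4.91)(b) and Thm. (4.63)(c); Raoufi2020, Prop. 1] -/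
theorem nn_freeCorr_eq_plusCorr_iff_edgeDensity_eq {β : ℝ} (hβ : 0 < β) (i : Fin d) :
    freeCorr d β 0 {0, Pi.single i 1} = plusCorr d β 0 {0, Pi.single i 1} ↔
      freeEdgeDensity d (fkIsingParam β) 2 s((0 : Site d), Pi.single i 1) =
        wiredEdgeDensity d (fkIsingParam β) 2 s((0 : Site d), Pi.single i 1) := by
  have hadj : (zdGraph d).Adj (0 : Site d) (Pi.single i 1) :=
    (zdGraph_adj_iff _ _).2 ⟨i, Or.inl (zero_add _).symm⟩
  rw [freeEdgeDensity_two_eq hβ.le hadj, wiredEdgeDensity_two_eq hβ.le hadj]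
  have hp : 0 < fkIsingParam β := fkIsingParam_pos_of_pos hβ
  constructor
  · intro h; rw [h]
  · intro h
    have h' := mul_left_cancel₀ hp.ne' (by linarith : fkIsingParam β * (1 + freeCorr d β 0 {0, Pi.single i 1}) =
      fkIsingParam β * (1 + plusCorr d β 0 {0, Pi.single i 1}))
    linarith

/-- **Wired does not exceed free on increasing box events, from one nearest-neighbour identity**
(Grimmett 2006, Thm. (4.63), (c) ⇒ (d), at `q = 2` through the dictionary): if
`⟨σ_0σ_{eᵢ}⟩^∅_{β,0} = ⟨σ_0σ_{eᵢ}⟩⁺_{β,0}` for one direction `i`, then for `p = 1 - e^{-2β}`, every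
`m` and every increasing event `A` of the configurations of `Λ_m`,
`inf_k φ¹_{Λ_{m+k},p,2}(A) ≤ sup_k φ⁰_{Λ_{m+k},p,2}(A)` — the tree's
`iInf_boxWiredReal_le_iSup_boxFreeReal` with its hypothesis `h⁰ = h¹` discharged by
`freeEdgeDensity_eq_wiredEdgeDensity_of_nn_freeCorr_eq_plusCorr`.
[cite: Grimmett2006, Thm. (4.63) ((c) ⇒ (d)) and Thm. (4.91)(b)] -/
theorem iInf_boxWiredReal_le_iSup_boxFreeReal_two_of_nn_freeCorr_eq_plusCorr {β : ℝ} (hβ : 0 ≤ β)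
    (i : Fin d) (h : freeCorr d β 0 {0, Pi.single i 1} = plusCorr d β 0 {0, Pi.single i 1})
    (m : ℕ) {A : Set (BondConfig ↥(box d m))} (hA : IsUpperSet A) :
    ⨅ k : ℕ, boxWiredReal d (fkIsingParam β) 2 m A k ≤ ⨆ k : ℕ, boxFreeReal d (fkIsingParam β) 2 m A k :=
  iInf_boxWiredReal_le_iSup_boxFreeReal i.pos (fkIsingParam_mem_Icc hβ) (by norm_num)
    (fun _ he => freeEdgeDensity_eq_wiredEdgeDensity_of_nn_freeCorr_eq_plusCorr hβ i h he) m hA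

/-- **Wired does not exceed free on increasing box events for FK–Ising, at every `β ≥ 0`, from
Raoufi's Proposition 1** (conditional on the named fact `Raoufi2020_nn_freeCorr_eq_plusCorr`;
Grimmett 2006, Thm. (4.63), (c) ⇒ (d)): for `d ≥ 1`, `p = 1 - e^{-2β}`, every `m` and every
increasing event `A` of the configurations of `Λ_m`, `inf_k φ¹_{Λ_{m+k},p,2}(A) ≤ sup_k φ⁰_{Λ_{m+k},p,2}(A)`.
With `A = {0 ↔ ∂Λ_m}` this is the comparison `θ¹(p,2) ≤ θ⁰(p,2)` behind the uniqueness of the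
infinite-volume FK–Ising measure at every `p`, in particular at `p_c(2)`.
[cite: Raoufi2020, Prop. 1 and Cor. 3; Grimmett2006, Thm. (4.63) ((c) ⇒ (d))] -/
theorem iInf_boxWiredReal_le_iSup_boxFreeReal_two_of_raoufi (h : Raoufi2020_nn_freeCorr_eq_plusCorr)
    (hd : 1 ≤ d) {β : ℝ} (hβ : 0 ≤ β) (m : ℕ) {A : Set (BondConfig ↥(box d m))} (hA : IsUpperSet A) :
    ⨅ k : ℕ, boxWiredReal d (fkIsingParam β) 2 m A k ≤ ⨆ k : ℕ, boxFreeReal d (fkIsingParam β) 2 m A k :=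
  iInf_boxWiredReal_le_iSup_boxFreeReal_two_of_nn_freeCorr_eq_plusCorr hβ ⟨0, hd⟩ (h d β hd hβ ⟨0, hd⟩) m hA

end InfiniteVolume

end Literature.Probability.LatticeModels

end
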